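import Summits.Ventures.HodgeRepro2.T7SupportCompactRegularPoint
import Summits.Ventures.HodgeRepro2.T7SupportTorusProjector

/-!
# The compact place for the one-vector `f`: the standard representation of `U(2)` (support, seat p1)

The compact-place (`ι₁`) twin of `T7SupportBergmanOneVectorFourier` (row 701): on `V = ℂ²` with the standard
representation `std g x = g x` of `U(2)` (`Matrix.toEuclideanCLM`; unitary, `isUnitaryRep_std`; strongly continuous,
`continuous_std_apply`), the tori `ρ_A(u) = diag(u, 1)`, `ρ_B(w) = diag(1, w)`, and the `ρ_A`-weight vector `e₀`
(weight `1`; `ρ_B`-weight `0`), `e₁` of `ρ_B`-weight `1`. The second-torus projector of `T7SupportTorusProjector`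
is linear here (`torusProj_add`, `torusProj_smul`), `std(h⁻¹) e₀ = conj(h₀₀) e₀ + conj(h₀₁) e₁`
(`std_inv_single_zero`), so

  **`P_1 (std(h⁻¹) e₀) = conj(h₀₁) • e₁`**   (`torusProj_std_inv_single_zero`),

and with row 703's `fourierCoeff_one_ne_zero_iff`: **`hq` at the compact place (standard `τ`, `q = 1`) holds iff
`h₀₁ ≠ 0`, i.e. iff `γ₀ = 1` is regular (`κ(1) ≠ 1`), i.e. iff `h ∉ K`** (`hq_std_iff`, `hq_std_iff_kappa`). The same
conclusion as row 701 at the rank-one places for the lowest `K`-type. (For a general irreducible `Symⁿ ⊗ detᵐ` of `U(2)`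
the components of `τ(h⁻¹) e₀` carry binomial coefficients times `h₀₀^{n−j} h₀₁^j` — non-zero iff `h₀₀ h₀₁ ≠ 0` — in
words; the dictionary `U(W_A)(F_{ι₁}) ≅ U(2)` stays with the line.)

Explicit model only; nothing about the adelic group or any period.
Blind lane: Mathlib + the HodgeRepro2 prefix only; no sorry; axioms ⊆ {propext, Classical.choice, Quot.sound}.
-/

namespace Summit.Ventures.HodgeRepro2.T7SupportCompactOneVectorStandard

open Matrix MeasureTheory
open scoped InnerProductSpace
open T5HaarCircle T7SupportTwoTorusInvariant T7SupportWeightTorusOrbital T7SupportOneVectorOrbital T7SupportTorusProjector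
  T7SupportCompactRegularPoint

/-- `ℂ²` with the Euclidean inner product -/
abbrev V := EuclideanSpace ℂ (Fin 2)

/-- **the standard representation** of `U(2)` on `ℂ²` -/
noncomputable def std : U2 →* (V →ₗ[ℂ] V) where
  toFun g := (Matrix.toEuclideanCLM (n := Fin 2) (𝕜 := ℂ) (g : Matrix (Fin 2) (Fin 2) ℂ) : V →L[ℂ] V)
  map_one' := by
    ext x
    simp
  map_mul' g g' := by
    ext x
    simp [map_mul]

/-- `std g x = g x` -/
theorem std_apply (g : U2) (x : V) :
    std g x = Matrix.toEuclideanCLM (n := Fin 2) (𝕜 := ℂ) (g : Matrix (Fin 2) (Fin 2) ℂ) x := rfl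

/-- the coordinates of `std g x`: `(g x)_i = Σ_j g i j x j` -/
theorem ofLp_std_apply (g : U2) (x : V) :
    WithLp.ofLp (std g x) = (g : Matrix (Fin 2) (Fin 2) ℂ) *ᵥ WithLp.ofLp x := rfl

/-- **the standard representation is unitary** -/
theorem isUnitaryRep_std : IsUnitaryRep std := by
  intro g x y
  set T : V →L[ℂ] V := Matrix.toEuclideanCLM (n := Fin 2) (𝕜 := ℂ) (g : Matrix (Fin 2) (Fin 2) ℂ) with hT
  have hTT : ContinuousLinearMap.adjoint T ∘L T = 1 := by
    rw [hT, ← ContinuousLinearMap.star_eq_adjoint, ← map_star, ← ContinuousLinearMap.mul_def, ← map_mul,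
      Matrix.UnitaryGroup.star_mul_self, map_one]
  change ⟪T x, T y⟫_ℂ = ⟪x, y⟫_ℂ
  rw [← ContinuousLinearMap.adjoint_inner_right]
  have : ContinuousLinearMap.adjoint T (T y) = y := by
    have := congrArg (fun L : V →L[ℂ] V => L y) hTT
    simpa using this
  rw [this]


/-- **strong continuity**: `g ↦ std g x` is continuous (finite dimension) -/
theorem continuous_std_apply (x : V) : Continuous fun g : U2 => std g x := by
  have h1 : Continuous fun g : U2 => (g : Matrix (Fin 2) (Fin 2) ℂ) := continuous_subtype_val
  have h2 : Continuous fun A : Matrix (Fin 2) (Fin 2) ℂ =>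
      (Matrix.toEuclideanCLM (n := Fin 2) (𝕜 := ℂ) A : V →L[ℂ] V) :=
    LinearMap.continuous_of_finiteDimensional
      ((Matrix.toEuclideanCLM (n := Fin 2) (𝕜 := ℂ)).toAlgEquiv.toLinearEquiv.toLinearMap)
  exact (ContinuousLinearMap.apply ℂ V x).continuous.comp (h2.comp h1)

/-! ### The two tori -/

/-- `diag(a, b)` is unitary for `a, b` on the circle -/
theorem diagonal_mem (a b : Circle) : Matrix.diagonal ![(a : ℂ), (b : ℂ)] ∈ Matrix.unitaryGroup (Fin 2) ℂ := by
  rw [Matrix.mem_unitaryGroup_iff, Matrix.star_eq_conjTranspose, Matrix.diagonal_conjTranspose,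
    Matrix.diagonal_mul_diagonal]
  ext i j
  fin_cases i <;> fin_cases j <;>
    simp [Matrix.diagonal, Complex.mul_conj, Circle.normSq_coe]

/-- the diagonal torus element `diag(a, b)` -/
noncomputable def diagU (a b : Circle) : U2 := ⟨Matrix.diagonal ![(a : ℂ), (b : ℂ)], diagonal_mem a b⟩

/-- `diag(a, b) diag(a', b') = diag(a a', b b')` -/
theorem diagU_mul (a b a' b' : Circle) : diagU a b * diagU a' b' = diagU (a * a') (b * b') := by
  apply Subtype.ext
  change Matrix.diagonal ![(a : ℂ), (b : ℂ)] * Matrix.diagonal ![(a' : ℂ), (b' : ℂ)] = _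
  rw [Matrix.diagonal_mul_diagonal]
  congr 1
  ext i
  fin_cases i <;> simp

/-- **the first torus** `ρ_A(u) = diag(u, 1)` -/
noncomputable def rhoA : Circle →* U2 where
  toFun u := diagU u 1
  map_one' := by
    apply Subtype.ext
    change Matrix.diagonal ![((1 : Circle) : ℂ), ((1 : Circle) : ℂ)] = 1
    have : ![((1 : Circle) : ℂ), ((1 : Circle) : ℂ)] = fun _ => 1 := by
      ext i
      fin_cases i <;> simp
    rw [this, Matrix.diagonal_one]
  map_mul' u u' := by rw [diagU_mul, mul_one]

/-- **the second torus** `ρ_B(w) = diag(1, w)` -/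
noncomputable def rhoB : Circle →* U2 where
  toFun w := diagU 1 w
  map_one' := by
    apply Subtype.ext
    change Matrix.diagonal ![((1 : Circle) : ℂ), ((1 : Circle) : ℂ)] = 1
    have : ![((1 : Circle) : ℂ), ((1 : Circle) : ℂ)] = fun _ => 1 := by
      ext i
      fin_cases i <;> simp
    rw [this, Matrix.diagonal_one]
  map_mul' w w' := by rw [diagU_mul, mul_one]

/-- `ρ_B` is continuous -/
theorem continuous_rhoB : Continuous rhoB := by
  apply Continuous.subtype_mk
  change Continuous fun w : Circle => Matrix.diagonal ![((1 : Circle) : ℂ), (w : ℂ)]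
  apply Continuous.matrix_diagonal
  refine continuous_pi fun i => ?_
  fin_cases i
  · exact continuous_const
  · exact continuous_subtype_val

/-- the basis vectors `e₀, e₁` -/
noncomputable def e (i : Fin 2) : V := EuclideanSpace.single i 1

/-- `std (diag(a, b)) e_i = d_i • e_i` -/
theorem std_diagU_e (a b : Circle) (i : Fin 2) : std (diagU a b) (e i) = (![(a : ℂ), (b : ℂ)] i) • e i := by
  apply WithLp.ofLp_injective
  rw [ofLp_std_apply]
  change Matrix.diagonal ![(a : ℂ), (b : ℂ)] *ᵥ WithLp.ofLp (EuclideanSpace.single i 1) =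
    WithLp.ofLp ((![(a : ℂ), (b : ℂ)] i) • EuclideanSpace.single i 1)
  ext j
  rw [Matrix.mulVec_diagonal, PiLp.ofLp_single, WithLp.ofLp_smul, PiLp.ofLp_single, Pi.smul_apply, Pi.single_apply,
    smul_eq_mul]
  split_ifs with hji
  · subst hji
    ring
  · simp

/-- `e₀` is a `ρ_A`-weight vector of weight `1` -/
theorem isWeightVector_rhoA_e0 : IsWeightVector std rhoA 1 (e 0) := by
  intro u
  change std (diagU u 1) (e 0) = (u : ℂ) ^ (1 : ℤ) • e 0
  rw [std_diagU_e, zpow_one]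
  simp

/-- `e₀` is a `ρ_B`-weight vector of weight `0` -/
theorem isWeightVector_rhoB_e0 : IsWeightVector std rhoB 0 (e 0) := by
  intro w
  change std (diagU 1 w) (e 0) = (w : ℂ) ^ (0 : ℤ) • e 0
  rw [std_diagU_e, zpow_zero]
  simp

/-- `e₁` is a `ρ_B`-weight vector of weight `1` -/
theorem isWeightVector_rhoB_e1 : IsWeightVector std rhoB 1 (e 1) := by
  intro w
  change std (diagU 1 w) (e 1) = (w : ℂ) ^ (1 : ℤ) • e 1
  rw [std_diagU_e, zpow_one]
  simp

/-- **`std(h⁻¹) e₀ = conj(h₀₀) e₀ + conj(h₀₁) e₁`** (`h⁻¹ = hᴴ`) -/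
theorem std_inv_e0 (h : U2) :
    std h⁻¹ (e 0) = (starRingEnd ℂ) (matU h 0 0) • e 0 + (starRingEnd ℂ) (matU h 0 1) • e 1 := by
  apply WithLp.ofLp_injective
  rw [ofLp_std_apply, Matrix.UnitaryGroup.inv_apply, Matrix.star_eq_conjTranspose]
  ext j
  simp only [e, WithLp.ofLp_add, WithLp.ofLp_smul, PiLp.ofLp_single, Matrix.mulVec, dotProduct, Fin.sum_univ_two,
    Matrix.conjTranspose_apply]
  fin_cases j <;> simp [matU]


/-- `|h₀₁|² = |h₁₀|²` for `h ∈ U(2)` (row and column relations) -/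
theorem normSq_zero_one_eq (h : U2) : Complex.normSq (matU h 0 1) = Complex.normSq (matU h 1 0) := by
  have hrow := Matrix.mem_unitaryGroup_iff.1 h.2
  rw [Matrix.star_eq_conjTranspose] at hrow
  have h00 := congrFun (congrFun hrow 0) 0
  simp [Matrix.mul_apply, Fin.sum_univ_two, Matrix.conjTranspose_apply] at h00
  have hr : Complex.normSq (matU h 0 0) + Complex.normSq (matU h 0 1) = 1 := by
    have e : (Complex.normSq (matU h 0 0) : ℂ) + (Complex.normSq (matU h 0 1) : ℂ) = 1 := by
      rw [Complex.normSq_eq_conj_mul_self, Complex.normSq_eq_conj_mul_self]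
      linear_combination h00
    exact_mod_cast e
  have hc := normSq_add_normSq h
  linarith

/-- the integrand of the projector is continuous for every vector (strong continuity along `ρ_B`) -/
theorem continuous_std_rhoB (x : V) : Continuous fun w : Circle => std (rhoB w) x :=
  (continuous_std_apply x).comp continuous_rhoB

/-- `e₁ ≠ 0` -/
theorem e_ne_zero (i : Fin 2) : e i ≠ 0 := by
  intro h0
  have := congrArg (fun v : V => v i) h0
  simp [e] at this

variable [MeasurableSpace Circle] [BorelSpace Circle]

/-- the projector is additive -/
theorem torusProj_add (q : ℤ) (x y : V) :
    torusProj std rhoB q (x + y) = torusProj std rhoB q x + torusProj std rhoB q y := by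
  unfold torusProj
  simp_rw [map_add, smul_add]
  exact integral_add (integrable_of_continuous (continuous_integrand std rhoB q (continuous_std_rhoB x)))
    (integrable_of_continuous (continuous_integrand std rhoB q (continuous_std_rhoB y)))

omit [BorelSpace Circle] in
/-- the projector is homogeneous -/
theorem torusProj_smul (q : ℤ) (c : ℂ) (x : V) : torusProj std rhoB q (c • x) = c • torusProj std rhoB q x := by
  unfold torusProj
  simp_rw [map_smul, smul_comm _ c]
  exact integral_smul c _

/-- **`P_1 (std(h⁻¹) e₀) = conj(h₀₁) • e₁`** -/
theorem torusProj_std_inv_e0 (h : U2) :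
    torusProj std rhoB 1 (std h⁻¹ (e 0)) = (starRingEnd ℂ) (matU h 0 1) • e 1 := by
  rw [std_inv_e0, torusProj_add, torusProj_smul, torusProj_smul, torusProj_weightVector isWeightVector_rhoB_e0,
    torusProj_weightVector isWeightVector_rhoB_e1]
  simp

/-- **`hq` at the compact place for the standard representation** (`q = 1`, `u_A = e₀`): `Φ_1(1) ≠ 0 ⟺ h₀₁ ≠ 0` -/
theorem hq_std_iff (h : U2) :
    T7SupportOneVectorOrbital.fourierCoeff std (e 0) h rhoB 1 1 ≠ 0 ↔ matU h 0 1 ≠ 0 := by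
  rw [fourierCoeff_one_ne_zero_iff isUnitaryRep_std (e 0) h rhoB 1 (continuous_std_rhoB _), torusProj_std_inv_e0,
    smul_ne_zero_iff, map_ne_zero]
  exact ⟨fun hh => hh.1, fun hh => ⟨hh, e_ne_zero 1⟩⟩

/-- **`hq` at the compact place ⟺ `γ₀ = 1` is regular ⟺ `h ∉ K`** -/
theorem hq_std_iff_kappa (h : U2) :
    T7SupportOneVectorOrbital.fourierCoeff std (e 0) h rhoB 1 1 ≠ 0 ↔
      kappa (starRingEnd ℂ) dd2 (colBasis h) (matU 1) ≠ 1 := by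
  rw [hq_std_iff, Ne, Ne, kappa_eq_one_iff 1 h, one_mul]
  have := normSq_zero_one_eq h
  constructor
  · intro h01 h10
    apply h01
    rw [h10, map_zero] at this
    exact Complex.normSq_eq_zero.1 this
  · intro h10 h01
    apply h10
    rw [h01, map_zero] at this
    exact Complex.normSq_eq_zero.1 this.symm

/-- **`a_{γ₀} ≠ 0` at `γ₀ = 1` for the one-vector `f` of `e₀` at the compact place** (first-torus character `u⁻¹`,
second-torus character `conj(w)`), whenever `h ∉ K` -/
theorem torus_orbital_std_one_ne_zero (h : U2) (hb : matU h 0 1 ≠ 0) :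
    ∫ u : Circle, ∫ w : Circle,
        coeff std (e 0) (e 0) (rhoA u * 1 * (h * rhoB w * h⁻¹)) *
          ((u : ℂ) ^ (-(1 : ℤ)) * (starRingEnd ℂ) ((w : ℂ) ^ (1 : ℤ)))
        ∂haarCircle ∂haarCircle ≠ 0 :=
  torus_orbital_one_vector_at_one_ne_zero isUnitaryRep_std isWeightVector_rhoA_e0 h rhoB 1
    (by
      have := (hq_std_iff h).2 hb
      unfold T7SupportOneVectorOrbital.fourierCoeff at this
      simpa using this)

end Summit.Ventures.HodgeRepro2.T7SupportCompactOneVectorStandard
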